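import Summits.Langlands.Langlands.Theorems.QuadraticWindowHostInducedRep
import HarnessLib

/-!
# `QuadraticWindow.HostInducedRepOfPrintedInputs` — the printed-input glue of the route, conditional
# on the nine remaining named facts of line `one-transparent-pane`

Item stmt-Langlands-16559 (route `QuadraticWindow`, support glue, route-repair 2026-08-16):
`HostInducedRepOfPrintedInputs := GaloisRepOfUnitaryLDS → AutomorphicInductionUnramified →
PartialAsaiLAtOne → HostInducedRep`.  The three hypotheses are the route's PRINTED-INPUT cruxes
(Goldring–Koskivirta 2019 Thm. 3.5.5; cyclic automorphic induction with Hecke–Satake at every unramified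
place; Grbac–Shahidi 2015 Thm. 4.3 at `s = 1`); each is, verbatim, the body of the Literature named
fact it was promoted from (`GaloisRepOfUnitaryLDS ↔ GoldringKoskivirta2019_galoisRep_unitary`, and
`automorphicInductionUnramified_iff`, `partialAsaiLAtOne_iff` below — all `Iff.rfl`).

What the tree proves today (this file): the glue follows from the landed closure of the crux along
line `one-transparent-pane`, `Summit.Langlands.Langlands.Theorems.HostInducedRep_proof_eleven`
(`Theorems/QuadraticWindowHostInducedRep.lean`), by feeding it the two hypotheses `AI` and `GS`; what is
left is that theorem's other NINE inputs, all unproved published theorems stated as named facts of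
`Literature/` (or inline): lang.S27 `exists_galoisRep_of_regularAlgebraic` (Harris–Lan–Taylor–Thorne
Thm. A + Varma), `FakhruddinPilloni2021_galoisRep_of_weaklyRegular_oddCont` (F–P 2021 Thm. 9.10),
`JacquetShalika1981_isEssConjSelfDual_of_isConjSelfDualAE` (J–S 1981 II Thm. 4.4),
`ArthurClozel1989_cuspidalBaseChange_unramified` (A–C Ch. 3 Thm. 4.2 (a) + 5.1), the Hecke-character
extension along a quadratic `K/F₀` (Hewitt–Ross (24.12), inline),
`ArthurClozel1989_strongLifting_archimedean` (A–C Ch. 3 Thm. 5.1, archimedean part),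
`Henniart2012_infinityType_of_automorphicInduction` (Henniart 2012 Thm. 3/5),
`Mok2014_archimedean_parity_of_asaiSignCont` (Mok 2014 Thm. 2.4.10 + Cor. 2.5.5),
`Mok2014_partialAsaiL_continuation_pole_dichotomy` (Mok 2014 Thm. 2.5.4 (a)).
So `HostInducedRepOfPrintedInputs_proof` is CONDITIONAL (trust base = the nine names) and does not
settle the item; the first hypothesis `GaloisRepOfUnitaryLDS` is idle along this line (it is consumed
only by line `grs-explicit-descent`, itself open at its stubs S2/S3/S5).  The dependency matrix of
`HostInducedRep_proof_eleven` is inherited: ranks `n ≤ 1` use no fact, `F` totally real or CM uses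
lang.S27 only (`inducedPackage_of_S27`); the mixed-signature case `n ≥ 2` — the route's NEW case — uses
all nine.
-/

set_option linter.dupNamespace false -- `Summit.Langlands.Langlands.…` repeats `Langlands` by design (D-0017)

noncomputable section

open Polynomial
open scoped NumberField
open IsDedekindDomain Field NumberField Filter
open Literature.NumberTheory.GaloisRepresentations Literature.NumberTheory.Automorphic
open Summit.Langlands.Langlands.Theses.QuadraticWindow

namespace Summit.Langlands.Langlands.Theorems

/-! ## Two of the three printed inputs are their named facts, verbatim -/

/-- The route crux `AutomorphicInductionUnramified` (stmt-Langlands-15138) is, verbatim, the Literature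
named fact `automorphicInduction_cyclic_cuspidal_unramified` (Arthur–Clozel Ch. 3 Thm. 6.2 + Henniart
2012 Thm. 3/5). [cite: ArthurClozelAMS120, Ch. 3 Thm. 6.2] -/
theorem automorphicInductionUnramified_iff :
    AutomorphicInductionUnramified ↔ automorphicInduction_cyclic_cuspidal_unramified :=
  Iff.rfl

/-- The route crux `PartialAsaiLAtOne` (stmt-Langlands-16407) is, verbatim, the Literature named fact
`GrbacShahidi2015_partialAsaiL_at_one` (Grbac–Shahidi 2015, Thm. 4.3 at `s = 1`).
[cite: GrbacShahidi2015, Thm. 4.3] -/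
theorem partialAsaiLAtOne_iff :
    PartialAsaiLAtOne ↔ GrbacShahidi2015_partialAsaiL_at_one :=
  Iff.rfl

/-! ## The glue, conditional on the nine remaining named facts -/

/-- **`HostInducedRepOfPrintedInputs_proof` — the support glue of route `QuadraticWindow`
(stmt-Langlands-16559), CONDITIONAL on nine published named facts.**  Given lang.S27,
Fakhruddin–Pilloni 9.10 (continuation form), Jacquet–Shalika SMO (pairing form), Arthur–Clozel
placewise cuspidal base change, the Hecke-character extension along a quadratic `K/F₀` (Hewitt–Ross
(24.12), inline), Arthur–Clozel archimedean strong lifting, Henniart's infinity type of automorphic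
induction, Mok's archimedean parity pin and Mok's Asai-pole dichotomy, the three printed inputs of the
route imply the host engine output `HostInducedRep`: the second and third (`AI`, `GS`) are fed — as
the named facts they literally are — to the landed `HostInducedRep_proof_eleven`; the first (`GK`,
Goldring–Koskivirta 3.5.5) is not used by this line.  This theorem does NOT settle the item: its trust
base is exactly the nine names above. [cite: FakhruddinPilloni2021, Thm. 9.10]
[cite: Mok2014, Thm. 2.5.4 (a) and Cor. 2.5.5] [cite: ArthurClozelAMS120, Ch. 3 Thm. 4.2, 5.1, 6.2]
[cite: HarrisLanTaylorThorneRMS2016, Thm. A] [cite: GrbacShahidi2015, Thm. 4.3] -/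
theorem HostInducedRepOfPrintedInputs_proof
    (hS27 : exists_galoisRep_of_regularAlgebraic)
    (hFP : FakhruddinPilloni2021_galoisRep_of_weaklyRegular_oddCont)
    (hSMO : JacquetShalika1981_isEssConjSelfDual_of_isConjSelfDualAE)
    (hBC : ArthurClozel1989_cuspidalBaseChange_unramified)
    (hExt : ∀ (F₀ K : Type) [Field F₀] [NumberField F₀] [Field K] [NumberField K] [Algebra F₀ K]
        (c : K ≃ₐ[F₀] K), Module.finrank F₀ K = 2 → c ≠ 1 →
        ∀ (χ₀ : HeckeCharacter F₀), χ₀.IsUnitary →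
        ∀ (U : Set (HeightOneSpectrum (𝓞 K))),
          (∀ u ∈ U, c • u ∈ U → χ₀.IsUnramifiedAt (u.under (𝓞 F₀))) →
          ∃ χ : HeckeCharacter K, χ.IsUnitary ∧
            (∀ x, χ (AdeleRing.ideleBaseChange F₀ K x) = χ₀ x) ∧ ∀ u ∈ U, χ.IsUnramifiedAt u)
    (hArchBC : ArthurClozel1989_strongLifting_archimedean)
    (hHen : Henniart2012_infinityType_of_automorphicInduction)
    (hPin : Mok2014_archimedean_parity_of_asaiSignCont)
    (hMok : Mok2014_partialAsaiL_continuation_pole_dichotomy) :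
    Summit.Langlands.Langlands.Theses.QuadraticWindow.HostInducedRepOfPrintedInputs :=
  fun _hGK hAI hGS ↦
    HostInducedRep_proof_eleven hS27 hFP hSMO (automorphicInductionUnramified_iff.mp hAI) hBC hExt
      hArchBC hHen hPin hMok (partialAsaiLAtOne_iff.mp hGS)

end Summit.Langlands.Langlands.Theorems

end
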